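import Summits.HodgeConjecture.HodgeConjecture.Theorems.Ring2TransportWeilTypeGeneralCMFieldSU
import Literature.AlgebraicGeometry.HodgeTheory.WeilClassesFieldRationalSpan
import HarnessLib

/-!
# Ring 2 · §transport (gen 5, viii-d) — row T6-CM with the DESCENT INPUT DISCHARGED

HONEST FRAMING (page 1, verbatim for the whole cell). Research route conditional on `HC_CM`; not a corollary;
Q11.4-sentence-2 already refuted in dim ≥ 3 (`HodgeTheory/SemiregularityWeakCriterionAbelianCounterexample`,
`qminus_det_ne_zero`). Every statement below is a kernel-checked implication between NAMED OPEN HYPOTHESES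
(binders, never facts) or an on-path remark; `HC_CM := Theses.RankFourFaces.CMAbelianHodge`
(item stmt-HodgeConjecture-3052; this file rides `--supports stmt-HodgeConjecture-16267` = `CMToAbelian`, ref1 F31) is an
explicit binder wherever it occurs. Fact #24 (Milne's endnote 16 to the 2003
re-edition of Deligne 1982 §4 / Milne 2025 Ex. 1.17) is UNREFEREED for `[E:ℚ] > 2` and enters only as the binder
`h24 : Deligne1982_hodgeRing_weilTypeCM_of_hodgeGroupSU`; Moonen–Zarhin's criterion only as the binder `hMZ`.

WHAT THIS FILE DOES. Row T6-CM (`Ring2TransportWeilTypeGeneralCMFieldSU`, p189510) read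
`HC_CM → CMPointedWeilFamiliesCMField → WeilVariationalHodgeCMField → (#24) → (MZ) → (descent) →
HodgeGeneralWeilTypeCMField`, where "(descent)" was the cell-minted binder
`WeilClassesFieldRationallySpanned` ("`W_E ⊗ ℂ` is spanned by its rational classes", for ALL `P ∈ ℤ[T]`).
The Literature THEOREM `HodgeTheory.weilClassesField_le_span_isRationalClass` (file
`HodgeTheory/WeilClassesFieldRationalSpan`, §lit gen 8, p190123; Moonen–Zarhin 1998 §1 on the tree's spectral
carrier) proves that statement for every `P` IRREDUCIBLE over `ℚ` with `P(φ) = 0` — which is exactly the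
instance a Weil-type structure `IsWeilTypeCM A η R e₀ k` supplies (`hW.irreducible`, `hW.eval₂_eq_zero`,
`P = R(T²)`, degree `2k`). Hence the descent binder DROPS OUT of every T6-CM row:

* `weilClassesField_le_span_isRationalClass_of_isWeilTypeCM` — the instance, from `IsWeilTypeCM`.
* `hodgeConjectureFor_weilTypeCM_general` — the `(A, η)`-slice: `#24 → MZ → (rational (k,k) Weil classes of
  (A, η) algebraic) → HC(A)` for a general Weil-type `(A, η)`, no descent binder.
* `hodgeGeneralWeilTypeCMField_of_weilClassesCMField'` — **R3 ⟹ T6-CM granted only #24 and MZ**.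
* `HC_GeneralWeilTypeCMField_of_HC_CM'` — **row T6-CM: `HC_CM → CMPointedWeilFamiliesCMField →
  WeilVariationalHodgeCMField → (#24) → (MZ) → HodgeGeneralWeilTypeCMField`** (five binders; `HC_CM` nominal:
  `HC_GeneralWeilTypeCMField_of_divisorGeneratedCMPointed'`).
* `hodgeGeneralWeilTypeCMField_position'` — where T6-CM sits now: `HC_AV ⟹ T6-CM ⟸ R3 (granted #24, MZ)`.

What remains OPEN on the row (all labelled ours/open or unrefereed, all binders): the Weil-confined variational
Hodge conjecture `WeilVariationalHodgeCMField` (Charles–Schnell Conj. 11.3.1 confined to flat Weil sections; the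
honest replacement of Markman's Q11.4 sentence 2), the CM-pointedness of the Weil families
(`CMPointedWeilFamiliesCMField`, or its `HC_CM`-free divisor-generated form), fact #24 (unrefereed for
`[E:ℚ] > 2`), and Moonen–Zarhin's published criterion (a named refereed fact, kept as a binder by the SU file).
The `∀ P` conjecture node `WeilClassesFieldRationallySpanned` itself stays in the tree as an open binder (its
reducible-`P` instances are not used anywhere); this file never asserts it.

References: [Deligne1982HodgeCycles] §4 (4.4), Prop. 4.4, Prop. 4.6, §5 and Milne's endnote 16 (2003
re-edition; UNREFEREED addition); [MoonenZarhin1998WeilClasses] §1 (definition of `W_F`, Lemma (1),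
`W_F ⊗ ℂ = ⊕_σ ⋀^r V_{ℂ,σ}`, Criterion); [CharlesSchnell2014Notes] Conj. 11.3.1; [vanGeemen1994HodgeAV] 4.9,
6.12; [Markman2025SecantRealMultiplication] (arXiv:2509.23079, preprint, unrefereed — statements only).
-/

noncomputable section

open CategoryTheory

namespace Summit.HodgeConjecture.HodgeConjecture.Ring2Transport

open Literature.AlgebraicGeometry Literature.AlgebraicGeometry.Motives
open Literature.AlgebraicGeometry.HodgeTheory
open Literature.AlgebraicGeometry.Deligne1982
open Literature.AlgebraicGeometry.VanGeemen1994 (pullbackOne hodgeClassSpan)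
open Literature.AlgebraicTopology.SingularHomology
open Summit.HodgeConjecture.HodgeConjecture.Theses
open Summit.HodgeConjecture.HodgeConjecture.WeilTypeLadder

set_option linter.dupNamespace false

variable {A : AbelianVariety ℂ} {η : A ⟶ A} {R : Polynomial ℤ} {e₀ k : ℕ}

/-- **The descent input at a Weil-type pair is a THEOREM.** For `(A, η, R, e₀, k)` of Weil type, the complexified
space of Weil classes `W_E ⊗ ℂ = weilClassesField A η R(T²) (2k)` is contained in the complex span of its rational
classes: `P_R = R(T²)` is irreducible over `ℚ` and `P_R(η) = 0` (`IsWeilTypeCM.irreducible`, `.eval₂_eq_zero`), so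
Moonen–Zarhin's `W_E ⊂ H^{2k}(A, ℚ)` with `W_E ⊗ ℂ = ⊕_σ ⋀^{2k} V_{ℂ,σ}` applies on the tree's carrier
(`HodgeTheory.weilClassesField_le_span_isRationalClass`, p190123).
[cite: MoonenZarhin1998WeilClasses, §1 (definition of W_F, Lemma (1), W_F ⊗ ℂ = ⊕_σ ⋀^r V_{ℂ,σ})]
[cite: Deligne1982HodgeCycles, §4 (4.4)] -/
theorem weilClassesField_le_span_isRationalClass_of_isWeilTypeCM (hW : IsWeilTypeCM A η R e₀ k) :
    weilClassesField A η (R.comp (Polynomial.X ^ 2)) (2 * k) ≤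
      Submodule.span ℂ {c | c ∈ weilClassesField A η (R.comp (Polynomial.X ^ 2)) (2 * k) ∧ IsRationalClass c} :=
  HodgeTheory.weilClassesField_le_span_isRationalClass hW.irreducible hW.eval₂_eq_zero (2 * k)

/-- At a Weil-type pair, `W_E ⊗ ℂ` IS the complex span of its rational classes (equality form).
[cite: MoonenZarhin1998WeilClasses, §1 (definition of W_F, Lemma (1))] -/
theorem weilClassesField_eq_span_isRationalClass_of_isWeilTypeCM (hW : IsWeilTypeCM A η R e₀ k) :
    weilClassesField A η (R.comp (Polynomial.X ^ 2)) (2 * k) =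
      Submodule.span ℂ {c | IsRationalClass c ∧ c ∈ weilClassesField A η (R.comp (Polynomial.X ^ 2)) (2 * k)} :=
  HodgeTheory.weilClassesField_eq_span_isRationalClass hW.irreducible hW.eval₂_eq_zero (2 * k)

/-- **The `(A, η)`-slice of row T6-CM, descent discharged**: for `(A, η, R, e₀, k)` of Weil type, general
(`HasHodgeGroupSUCM` at a Rosati-compatible polarization class `h`), GRANTED fact #24 (endnote; UNREFEREED for
`e₀ ≥ 2`) and Moonen–Zarhin's criterion, the algebraicity of the RATIONAL `(k,k)` Weil classes of THIS pair gives
`HodgeConjectureFor A.dim A.X`. (p189510's `hodgeConjectureFor_weilTypeCM_of_rational` minus its binder `hQ`.)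
[cite: Deligne1982HodgeCycles, §4 (4.4), Prop. 4.4 and Milne 2003 re-edition endnote 16]
[cite: MoonenZarhin1998WeilClasses, §1 (Criterion)] [cite: VoisinHodgeII2003, Prop. 9.20] -/
theorem hodgeConjectureFor_weilTypeCM_general
    (h24 : Deligne1982_hodgeRing_weilTypeCM_of_hodgeGroupSU) (hMZ : MoonenZarhin1998_weilClasses_hodgeCriterion)
    {h : complexBetti A.X 2} (hW : IsWeilTypeCM A η R e₀ k) (hpol : IsPolarizationClass A.dim A.X h)
    (hRos : ∀ x y : complexBetti A.X 1,
      polarizationPairingOne A.X h (A.dim - 1) (pullbackOne A η x) y =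
        -polarizationPairingOne A.X h (A.dim - 1) x (pullbackOne A η y))
    (hSU : HasHodgeGroupSUCM A η (R.comp (Polynomial.X ^ 2)) h)
    (hR : ∀ c ∈ weilClassesField A η (R.comp (Polynomial.X ^ 2)) (2 * k), IsRationalClass c →
      IsOfHodgeType A.dim A.X (2 * k) k k c → c ∈ algebraicClasses A.X k) :
    HodgeConjectureFor A.dim A.X :=
  hodgeConjectureFor_weilTypeCM_of_rational h24 hMZ hW hpol hRos hSU
    (weilClassesField_le_span_isRationalClass_of_isWeilTypeCM hW) hR

/-- **R3 ⟹ T6-CM granted ONLY fact #24 and Moonen–Zarhin's criterion** (the descent input of p189510's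
`hodgeGeneralWeilTypeCMField_of_weilClassesCMField` is now a theorem). No families, no `HC_CM`.
[cite: Deligne1982HodgeCycles, §4 (4.4) and Milne 2003 re-edition endnote 16]
[cite: MoonenZarhin1998WeilClasses, §1 (Lemma (1) and Criterion)] -/
theorem hodgeGeneralWeilTypeCMField_of_weilClassesCMField'
    (h24 : Deligne1982_hodgeRing_weilTypeCM_of_hodgeGroupSU) (hMZ : MoonenZarhin1998_weilClasses_hodgeCriterion)
    (hR3 : WeilClassesCMField) : HodgeGeneralWeilTypeCMField :=
  fun _ _ _ _ _ _ he hW hpol hRos hSU ↦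
    hodgeConjectureFor_weilTypeCM_general h24 hMZ hW hpol hRos hSU (weilClassesCMField_isWeilTypeCM hR3 he hW)

/-- The `∀ P` descent node of p189510 is no longer needed by the row: granted #24 and MZ, R3 gives T6-CM with or
without it (recorded so that no seat re-derives the binder). [cite: MoonenZarhin1998WeilClasses, §1 (Lemma (1))] -/
theorem hodgeGeneralWeilTypeCMField_of_weilClassesCMField_iff_withDescent
    (h24 : Deligne1982_hodgeRing_weilTypeCM_of_hodgeGroupSU) (hMZ : MoonenZarhin1998_weilClasses_hodgeCriterion) :
    (WeilClassesCMField → HodgeGeneralWeilTypeCMField) ∧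
      (WeilClassesFieldRationallySpanned → WeilClassesCMField → HodgeGeneralWeilTypeCMField) :=
  ⟨hodgeGeneralWeilTypeCMField_of_weilClassesCMField' h24 hMZ,
    fun hQ hR3 ↦ hodgeGeneralWeilTypeCMField_of_weilClassesCMField h24 hMZ hQ hR3⟩

/-- **Row T6-CM (descent discharged): `HC_CM → CMPointedWeilFamiliesCMField → WeilVariationalHodgeCMField →
(#24) → (MZ) → HodgeGeneralWeilTypeCMField`.** The CM-pointed Weil families make the Weil classes algebraic at CM
members by `HC_CM`; the Weil-confined variational Hodge conjecture (OPEN; Charles–Schnell Conj. 11.3.1 confined to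
flat Weil sections — the honest replacement of Markman's Q11.4 sentence 2, refuted in dim ≥ 3) transports them to
every member (rung R3, `HC_WeilClassesCMField_of_HC_CM`); Moonen–Zarhin's Lemma (1) (now a tree theorem on the
carrier) and Criterion pass from rational points to `W_E ⊗ ℂ ⊆ Nᵏ`; the endnote (#24) and the cup-closure theorem
give the whole Hodge ring of the GENERAL member. CONDITIONAL on the five named binders; `HC_CM` NOMINAL (next).
[cite: Deligne1982HodgeCycles, §4 (4.4), Prop. 4.4 and Milne 2003 re-edition endnote 16]
[cite: CharlesSchnell2014Notes, Conj. 11.3.1] [cite: MoonenZarhin1998WeilClasses, §1 (Lemma (1) and Criterion)] -/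
theorem HC_GeneralWeilTypeCMField_of_HC_CM' (hCM : Theses.RankFourFaces.CMAbelianHodge)
    (hP : CMPointedWeilFamiliesCMField) (hV : WeilVariationalHodgeCMField)
    (h24 : Deligne1982_hodgeRing_weilTypeCM_of_hodgeGroupSU) (hMZ : MoonenZarhin1998_weilClasses_hodgeCriterion) :
    HodgeGeneralWeilTypeCMField :=
  hodgeGeneralWeilTypeCMField_of_weilClassesCMField' h24 hMZ (HC_WeilClassesCMField_of_HC_CM hCM hP hV)

/-- **Row T6-CM WITHOUT `HC_CM`, descent discharged: `DivisorGeneratedCMPointedWeilFamiliesCMField →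
WeilVariationalHodgeCMField → (#24) → (MZ) → HodgeGeneralWeilTypeCMField`** — on row T6-CM `HC_CM` is NOMINAL.
[cite: Deligne1982HodgeCycles, §5] [cite: vanGeemen1994HodgeAV, 2.4] [cite: CharlesSchnell2014Notes, Conj. 11.3.1] -/
theorem HC_GeneralWeilTypeCMField_of_divisorGeneratedCMPointed'
    (hP : DivisorGeneratedCMPointedWeilFamiliesCMField) (hV : WeilVariationalHodgeCMField)
    (h24 : Deligne1982_hodgeRing_weilTypeCM_of_hodgeGroupSU) (hMZ : MoonenZarhin1998_weilClasses_hodgeCriterion) :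
    HodgeGeneralWeilTypeCMField :=
  hodgeGeneralWeilTypeCMField_of_weilClassesCMField' h24 hMZ (HC_WeilClassesCMField_of_divisorGeneratedCMPointed hP hV)

/-- **Where T6-CM sits now**: `HC_AV ⟹ T6-CM ⟸ R3`, the latter granted ONLY #24 (unrefereed for `[E:ℚ] > 2`) and
Moonen–Zarhin's criterion; and under `HC_CM` plus the two transport leaves the rung R3 is available. Honest reading
of row T6-CM after this file: "`HC_CM` nominal; content = Weil-confined variational Hodge (ours/open) + Milne's
endnote (unrefereed) + MZ's published criterion" — the descent lemma is no longer on the list.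
[cite: Deligne1982HodgeCycles, §4–§5 and Milne 2003 re-edition endnote 16] [cite: MoonenZarhin1998WeilClasses, §1] -/
theorem hodgeGeneralWeilTypeCMField_position' :
    (PadicSemiregularLift.HodgeAbelianVarieties → HodgeGeneralWeilTypeCMField) ∧
    (Deligne1982_hodgeRing_weilTypeCM_of_hodgeGroupSU → MoonenZarhin1998_weilClasses_hodgeCriterion →
      WeilClassesCMField → HodgeGeneralWeilTypeCMField) ∧
    (Theses.RankFourFaces.CMAbelianHodge → CMPointedWeilFamiliesCMField → WeilVariationalHodgeCMField →
      Deligne1982_hodgeRing_weilTypeCM_of_hodgeGroupSU → MoonenZarhin1998_weilClasses_hodgeCriterion →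
      HodgeGeneralWeilTypeCMField) :=
  ⟨hodgeGeneralWeilTypeCMField_of_hodgeAbelianVarieties, hodgeGeneralWeilTypeCMField_of_weilClassesCMField',
    HC_GeneralWeilTypeCMField_of_HC_CM'⟩

end Summit.HodgeConjecture.HodgeConjecture.Ring2Transport
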